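import Summits.ResolutionOfSingularities.ResolutionOfSingularities.Theorems.FrobeniusClosingPatchingRelPerfectDepthOneTargets
import Summits.ResolutionOfSingularities.ResolutionOfSingularities.Theorems.FrobeniusClosingPatchingRelPerfectOfAtomBlowup
import HarnessLib

/-!
# Crux `PatchingRelPerfect` (stmt-ResolutionOfSingularities-16161), chain W5.2 — programme r-d1 in
# COMPANION form, its closure under reductions and `𝔪`-primary factors, and the fold of the depth-one
# stratum into the composition of record (lead prover, gen 3)

[OURS · L1 W5.2 · lead] Replaces the role of NO printed item; NOT a statement of the manuscript under
review (Hironaka 2017 items are candidates, never premises; nothing here cites it).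

The typed targets «E» of res-L1-w52-plan-1 (`…DepthOneTargetsDefs`, `…DepthOneTargets`) prove the
depth-one rung `DepthOneConclusion` — the conclusion of the registered open core `stub_atomDimFourBlowup`
(skeleton `closed_point_slice` v5.1, sha `df2071be…`) on the stratum `HasExceptionalDepthOne x I` — from six
stub-sized targets and the two named facts CP (`CossartPiltant2019Principalization`, F-31) and CJS-B
(`CossartJannsenSaito2020EmbeddedSequenceB`, F-32bR), the composition `depthOne_of_targets'` being
kernel-checked. The proof passes through the COMPANION CLASS `𝒞(S) = {I : ∃ Q ⊇ 𝔪ᵐ, some Bl_{I·Q} Spec S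
regular}` (`TowerContraction`, then `atomConclusion_of_companion'`), but the typed conclusion only records the
weaker blow-up form. This file (holder of record of the crux, integration duty «fold landed helpers into
the composition») records the stronger statement and cashes it:

* §1 `HasExceptionalDepthOne` API: the sandwich form `(x_i^{d+1}) ⊆ I ⊆ 𝔪ᵈ` (= the hypothesis shape of
  rung r1t `coreRung_tangentCone` WITHOUT its chart-regularity input) and `𝔪`-primarity
  (`HasExceptionalDepthOne.exists_pow_maximalIdeal_le`, pigeonhole `CoreRung.span_pow_le_span_powers_mul_pow`).
* §2 `companion_of_steps` / `companion_of_targets'`: from I1 `ExceptionalPackage`, D1 `DictionaryStep`, D5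
  `TowerContraction` and Θ₃ `ControlledTrivialization₃` (resp. the six targets + CP + CJS-B), every non-zero
  depth-one ideal of a regular local ring of dimension four lies in `𝒞` — verbatim the body of plan-1's
  `dictionaryPiece_of_steps` stopped one line earlier.
* §3 PAYOFF — two strata the blow-up form does not reach, modulo the same targets:
  `coreRung_reduction_of_depthOne` — every `I ≠ 0` with `I · Kʳ = Kʳ⁺¹` for a depth-one `K` (all
  REDUCTIONS of depth-one ideals; e.g. four general elements of `𝔪ᵈ`, `d ≥ 2`, generate a reduction of
  `𝔪ᵈ` that is not of depth one in any regular system of parameters) satisfies the core's conclusion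
  (`companion_of_reduction`, r1d); `coreRung_of_mul_primary_depthOne` — so does every `I ≠ 0` such that
  `I · Q₀` is of depth one for some `𝔪`-primary `Q₀` (companions multiply).
* §4 `atomDimFourBlowupAt_of_depthOneConclusion`: `DepthOneConclusion` IS the registered stub's statement on
  its stratum, in the stub's exact binder shape (characteristic, completeness, residue field, off-fibre
  regularity unused) — the kernel-visible dent.
* §5 `patchingRelPerfect_of_printed_of_depthOne_of_deeper_of_dimGeFive`: the crux BY NAME from the printed
  dimension-`≤ 3` inputs, `DepthOneConclusion`, the open core RESTRICTED TO THE COMPLEMENT STRATUM (ideals of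
  depth one in NO regular system of parameters) and the parked dimension-`≥ 5` residual — the certificate
  `patchingRelPerfect_of_printed_of_atomDimFourBlowup_of_dimGeFive` (p462937 lineage) with the depth-one
  stratum split off. CONDITIONAL; the item stays open; no standing of the core is claimed.

HONEST SCOPE. Everything in §2–§3 is modulo the open typed targets (hypotheses BY NAME, to be discharged by
the `…_holds` theorems of the stub hands) and, in the primed forms, modulo the two named facts; §5 restates
nothing weaker — the complement stratum enters as a HYPOTHESIS of a conditional certificate, exactly as the
whole core does in p462937. AI-written; weaker than expert review.

## References
* The Stacks Project, Tags 080A, 080B. [StacksProject]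
* I. Swanson, C. Huneke, *Integral Closure of Ideals, Rings, and Modules* (2006), Def. 1.2.1 (reductions:
  only the identity `I Kʳ = Kʳ⁺¹` is used). [folklore]
* V. Cossart, O. Piltant, J. Algebra 529 (2019), Prop. 4.4. [CossartPiltant2019]
* V. Cossart, U. Jannsen, S. Saito, LNM 2270 (2020), Thm. 1.4, Thm. 6.9 (a). [CossartJannsenSaito2020]
-/

-- `Summit.<Summit>.<Sub>.Theorems` with `Sub = Summit` (single-conjunct summit, D-0017)
set_option linter.dupNamespace false

noncomputable section

open CategoryTheory CategoryTheory.Limits AlgebraicGeometry TopologicalSpace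
open Literature.AlgebraicGeometry.Resolution

namespace Summit.ResolutionOfSingularities.ResolutionOfSingularities.Theorems

universe u

namespace DepthOneTargets

/-! ## §1 `HasExceptionalDepthOne`: sandwich form and `𝔪`-primarity -/

/-- **Sandwich form of exceptional depth one**: `HasExceptionalDepthOne x I` iff
`(x_i^{d+1})_i ⊆ I ⊆ 𝔪ᵈ` for some `d` — the hypothesis shape of rung r1t (`coreRung_tangentCone`)
without its chart-regularity input. [folklore] -/
theorem hasExceptionalDepthOne_iff_sandwich {S : Type u} [CommRing S] [IsLocalRing S] {n : ℕ}
    (x : Fin n → S) (I : Ideal S) :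
    HasExceptionalDepthOne x I ↔ ∃ d : ℕ,
      Ideal.span (Set.range fun i => x i ^ (d + 1)) ≤ I ∧ I ≤ IsLocalRing.maximalIdeal S ^ d := by
  constructor
  · rintro ⟨d, hle, hmem⟩
    refine ⟨d, Ideal.span_le.mpr ?_, hle⟩
    rintro _ ⟨i, rfl⟩
    exact hmem i
  · rintro ⟨d, hspan, hle⟩
    exact ⟨d, hle, fun i => hspan (Ideal.subset_span ⟨i, rfl⟩)⟩

/-- The powers `𝔪ᵈ` themselves are of exceptional depth one (rung r0's family). [folklore] -/
theorem hasExceptionalDepthOne_pow_maximalIdeal {S : Type u} [CommRing S] [IsLocalRing S] {n : ℕ}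
    (x : Fin n → S) (hx : Ideal.span (Set.range x) = IsLocalRing.maximalIdeal S) (d : ℕ) :
    HasExceptionalDepthOne x (IsLocalRing.maximalIdeal S ^ d) := by
  refine ⟨d, le_rfl, fun i => ?_⟩
  have hxi : x i ∈ IsLocalRing.maximalIdeal S := hx ▸ Ideal.subset_span ⟨i, rfl⟩
  exact Ideal.pow_le_pow_right (Nat.le_succ d) (Ideal.pow_mem_pow hxi (d + 1))

/-- **Depth-one ideals are `𝔪`-primary**: if `x` spans `𝔪` and `HasExceptionalDepthOne x I`, then
`𝔪ᵐ ⊆ I` for some `m` (pigeonhole: `𝔪^{(d+1)+nd} ⊆ (x_i^{d+1}) · 𝔪^{nd} ⊆ I`). [folklore] -/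
theorem HasExceptionalDepthOne.exists_pow_maximalIdeal_le {S : Type u} [CommRing S] [IsLocalRing S]
    {n : ℕ} {x : Fin n → S} (hx : Ideal.span (Set.range x) = IsLocalRing.maximalIdeal S)
    {I : Ideal S} (h : HasExceptionalDepthOne x I) :
    ∃ m : ℕ, IsLocalRing.maximalIdeal S ^ m ≤ I := by
  obtain ⟨d, hspan, -⟩ := (hasExceptionalDepthOne_iff_sandwich x I).mp h
  refine ⟨d + 1 + n * d, ?_⟩
  have hnd : n * (d + 1 - 1) < d + 1 + n * d := by
    rw [Nat.add_sub_cancel]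
    omega
  calc IsLocalRing.maximalIdeal S ^ (d + 1 + n * d)
      = Ideal.span (Set.range x) ^ (d + 1 + n * d) := by rw [hx]
    _ ≤ Ideal.span (Set.range fun j => x j ^ (d + 1)) * Ideal.span (Set.range x) ^ (n * d) :=
        CoreRung.span_pow_le_span_powers_mul_pow x hnd
    _ ≤ Ideal.span (Set.range fun j => x j ^ (d + 1)) := Ideal.mul_le_right
    _ ≤ I := hspan

/-- In a regular local ring of Krull dimension four the maximal ideal is non-zero. [folklore] -/
theorem maximalIdeal_ne_bot_of_ringKrullDim_eq_four {S : Type u} [CommRing S] [IsRegularLocalRing S]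
    (hdim : ringKrullDim S = (4 : ℕ)) : IsLocalRing.maximalIdeal S ≠ ⊥ := by
  intro h
  have h0 : ringKrullDim S = 0 :=
    ringKrullDim_eq_zero_of_isField ((IsLocalRing.isField_iff_maximalIdeal_eq).mpr h)
  rw [h0] at hdim
  exact absurd hdim (by norm_num)

/-- A depth-one ideal of a regular local ring of dimension four is non-zero. [folklore] -/
theorem HasExceptionalDepthOne.ne_bot {S : Type u} [CommRing S] [IsRegularLocalRing S]
    (hdim : ringKrullDim S = (4 : ℕ)) {n : ℕ} {x : Fin n → S}
    (hx : Ideal.span (Set.range x) = IsLocalRing.maximalIdeal S) {I : Ideal S}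
    (h : HasExceptionalDepthOne x I) : I ≠ ⊥ := by
  haveI : IsDomain S := isDomain_of_isRegularLocalRing S
  obtain ⟨m, hm⟩ := h.exists_pow_maximalIdeal_le hx
  exact CoreRungClosure.ne_bot_of_pow_maximalIdeal_le (maximalIdeal_ne_bot_of_ringKrullDim_eq_four hdim) hm

/-! ## §2 The depth-one rung in COMPANION form -/

/-- [OURS · L1 W5.2 · lead] **r-d1 in companion form, from I1 + D1 + D5 + Θ₃.** For `S` regular local of
Krull dimension four, `x` spanning `𝔪` and `I ≠ 0` of exceptional depth one, SOME `𝔪`-primary `Q ⊇ 𝔪ᵐ`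
has a regular blowing up of `Spec S` along `I · Q` — i.e. `I ∈ 𝒞(S)`. Verbatim the composition
`dictionaryPiece_of_steps` of the typed targets (exceptional package, invariant along the controlled
sequence given by Θ₃, the dictionary's end, tower contraction) stopped before `atomConclusion_of_companion'`.
Modulo the open targets, taken as hypotheses BY NAME. [cite: StacksProject, Tag 080A] -/
theorem companion_of_steps (hpkg : ExceptionalPackage.{u}) (hstep : DictionaryStep.{u})
    (hD5 : TowerContraction.{u}) (hΘ : ControlledTrivialization₃.{u})
    (S : Type u) [CommRing S] [IsRegularLocalRing S] (hdim : ringKrullDim S = (4 : ℕ))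
    (n : ℕ) (x : Fin n → S) (hx : Ideal.span (Set.range x) = IsLocalRing.maximalIdeal S)
    (I : Ideal S) (hI : I ≠ ⊥) (hdepth : HasExceptionalDepthOne x I) :
    ∃ (Q : Ideal S) (m : ℕ), IsLocalRing.maximalIdeal S ^ m ≤ Q ∧
      ∃ (B : Scheme.{u}) (b : B ⟶ Spec (.of S)),
        IsBlowup b (affineBlowup.idealSheaf (I * Q)) ∧ Scheme.IsRegular B := by
  obtain ⟨X, E, g, i, 𝔟, hinv, hint, hnoeth, hexc, hdimE⟩ := hpkg S hdim n x hx I hI hdepth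
  have key : ∃ (X' : Scheme.{u}) (g' : X' ⟶ Spec (.of S)),
      (∃ K : (Spec (.of S)).IdealSheafData, IsBlowup g' K ∧
        (K.support : Set (Spec (.of S))) ⊆ {IsLocalRing.closedPoint S}) ∧
      Scheme.IsRegular X' ∧ IsLocallyPrincipal ((affineBlowup.idealSheaf I).comap g') := by
    by_cases h𝔟 : 𝔟 = ⊥
    · exact ⟨X, g, hinv.exists_isBlowup_supported, hinv.isRegular,
        dictionaryEnd_holds S I E X i g 𝔟 hinv (Or.inr h𝔟)⟩
    · haveI := hint
      haveI := hnoeth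
      obtain ⟨E', ρ, hρ⟩ := hΘ E hinv.isRegular_exc hexc hdimE 𝔟 h𝔟
      obtain ⟨X', i', g', hinv'⟩ := inv_along hstep hρ X i g hinv
      exact ⟨X', g', hinv'.exists_isBlowup_supported, hinv'.isRegular,
        dictionaryEnd_holds S I E' X' i' g' ⊤ hinv' (Or.inl rfl)⟩
  obtain ⟨X', g', ⟨K, hg', hK⟩, hX', hlp⟩ := key
  exact hD5 S I hI X' g' K hg' hK hX' hlp

/-- [OURS · L1 W5.2 · lead] **r-d1 in companion form from the SIX finest targets and the two named facts**
(A1 `PrincipalizeControlled`, A2s `RegularizeSupport`, S-A2 `DivisorialFactorization`, I1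
`ExceptionalPackage`, D1 `DictionaryStep`, D5 `TowerContraction`; CP, CJS-B as hypotheses — CONDITIONAL on
the named facts). [cite: CossartPiltant2019, Prop. 4.4] [cite: CossartJannsenSaito2020, Thm. 1.4] -/
theorem companion_of_targets' (hA1 : PrincipalizeControlled.{u}) (hA2s : RegularizeSupport.{u})
    (hfac : DivisorialFactorization.{u}) (hpkg : ExceptionalPackage.{u}) (hstep : DictionaryStep.{u})
    (hD5 : TowerContraction.{u}) (hCP : CossartPiltant2019Principalization.{u})
    (hCJS : CossartJannsenSaito2020EmbeddedSequenceB.{u})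
    (S : Type u) [CommRing S] [IsRegularLocalRing S] (hdim : ringKrullDim S = (4 : ℕ))
    (n : ℕ) (x : Fin n → S) (hx : Ideal.span (Set.range x) = IsLocalRing.maximalIdeal S)
    (I : Ideal S) (hI : I ≠ ⊥) (hdepth : HasExceptionalDepthOne x I) :
    ∃ (Q : Ideal S) (m : ℕ), IsLocalRing.maximalIdeal S ^ m ≤ Q ∧
      ∃ (B : Scheme.{u}) (b : B ⟶ Spec (.of S)),
        IsBlowup b (affineBlowup.idealSheaf (I * Q)) ∧ Scheme.IsRegular B :=
  companion_of_steps hpkg hstep hD5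
    (trivializationPiece_of_steps hA1
      (regularizePeel_of_divisorial (regularizeDivisorial_of_support hA2s hfac)) hCP hCJS)
    S hdim n x hx I hI hdepth

/-! ## §3 Payoff: reductions of depth-one ideals and `𝔪`-primary factors -/

/-- [OURS · L1 W5.2 · lead] **CORE RUNG r-d1ʳ — reductions of depth-one ideals** (modulo I1 + D1 + D5 +
Θ₃). `S` regular local of dimension four, `x` spanning `𝔪`, `K` of exceptional depth one, `I ≠ 0` with
`I · Kʳ = Kʳ⁺¹` (`I` a reduction of `K`; `r = 0` is `I = K`). Then every blowing up `f : T ⟶ Spec S` along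
`I` carries a non-zero ideal sheaf cosupported in the closed fibre with regular blowing up (companion
`Kʳ · Q_K`, r1d `companion_of_reduction`). Reductions of depth-one ideals are in general NOT of depth one,
so this stratum is strictly larger than that of `DepthOneConclusion`. [cite: StacksProject, Tag 080A] -/
theorem coreRung_reduction_of_depthOne (hpkg : ExceptionalPackage.{u}) (hstep : DictionaryStep.{u})
    (hD5 : TowerContraction.{u}) (hΘ : ControlledTrivialization₃.{u})
    {S : Type u} [CommRing S] [IsRegularLocalRing S] (hdim : ringKrullDim S = (4 : ℕ))
    {n : ℕ} (x : Fin n → S) (hx : Ideal.span (Set.range x) = IsLocalRing.maximalIdeal S)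
    {K : Ideal S} (hK : HasExceptionalDepthOne x K) {I : Ideal S} (hI : I ≠ ⊥) {r : ℕ}
    (hIK : I * K ^ r = K ^ (r + 1))
    (T : Scheme.{u}) (f : T ⟶ Spec (.of S)) (hf : IsBlowup f (affineBlowup.idealSheaf I)) :
    ∃ (J : T.IdealSheafData) (T' : Scheme.{u}) (π : T' ⟶ T), J ≠ ⊥ ∧
      (∀ t : T, t ∈ J.support → f.base t = IsLocalRing.closedPoint S) ∧
      IsBlowup π J ∧ Scheme.IsRegular T' := by
  obtain ⟨m, hKm⟩ := hK.exists_pow_maximalIdeal_le hx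
  exact coreRung_reduction_of_companion hI hKm hIK
    (companion_of_steps hpkg hstep hD5 hΘ S hdim n x hx K (hK.ne_bot hdim hx) hK) T f hf

/-- [OURS · L1 W5.2 · lead] **CORE RUNG r-d1ᵠ — `𝔪`-primary factors** (modulo I1 + D1 + D5 + Θ₃). If
`I ≠ 0` and `I · Q₀` is of exceptional depth one for some `𝔪`-primary `Q₀ ⊇ 𝔪^{m₀}`, then every blowing up
of `Spec S` along `I` satisfies the core's conclusion (companions multiply: `I · (Q₀ Q)`).
[cite: StacksProject, Tag 080A] -/
theorem coreRung_of_mul_primary_depthOne (hpkg : ExceptionalPackage.{u}) (hstep : DictionaryStep.{u})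
    (hD5 : TowerContraction.{u}) (hΘ : ControlledTrivialization₃.{u})
    {S : Type u} [CommRing S] [IsRegularLocalRing S] (hdim : ringKrullDim S = (4 : ℕ))
    {n : ℕ} (x : Fin n → S) (hx : Ideal.span (Set.range x) = IsLocalRing.maximalIdeal S)
    {I Q₀ : Ideal S} (hI : I ≠ ⊥) {m₀ : ℕ} (hQ₀ : IsLocalRing.maximalIdeal S ^ m₀ ≤ Q₀)
    (hIQ₀ : HasExceptionalDepthOne x (I * Q₀))
    (T : Scheme.{u}) (f : T ⟶ Spec (.of S)) (hf : IsBlowup f (affineBlowup.idealSheaf I)) :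
    ∃ (J : T.IdealSheafData) (T' : Scheme.{u}) (π : T' ⟶ T), J ≠ ⊥ ∧
      (∀ t : T, t ∈ J.support → f.base t = IsLocalRing.closedPoint S) ∧
      IsBlowup π J ∧ Scheme.IsRegular T' := by
  obtain ⟨Q, m, hQm, B, b, hb, hB⟩ :=
    companion_of_steps hpkg hstep hD5 hΘ S hdim n x hx (I * Q₀) (hIQ₀.ne_bot hdim hx) hIQ₀
  refine atomConclusion_of_companion' hI ⟨Q₀ * Q, m₀ + m, ?_, B, b, ?_, hB⟩ T f hf
  · rw [pow_add]
    exact Ideal.mul_mono hQ₀ hQm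
  · rwa [← mul_assoc]

/-- [OURS · L1 W5.2 · lead] **r-d1ʳ from the six finest targets and the two named facts** (CONDITIONAL on
CP, CJS-B): reductions of depth-one ideals satisfy the core's conclusion.
[cite: CossartPiltant2019, Prop. 4.4] [cite: CossartJannsenSaito2020, Thm. 1.4] -/
theorem coreRung_reduction_of_depthOne' (hA1 : PrincipalizeControlled.{u})
    (hA2s : RegularizeSupport.{u}) (hfac : DivisorialFactorization.{u}) (hpkg : ExceptionalPackage.{u})
    (hstep : DictionaryStep.{u}) (hD5 : TowerContraction.{u})
    (hCP : CossartPiltant2019Principalization.{u}) (hCJS : CossartJannsenSaito2020EmbeddedSequenceB.{u})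
    {S : Type u} [CommRing S] [IsRegularLocalRing S] (hdim : ringKrullDim S = (4 : ℕ))
    {n : ℕ} (x : Fin n → S) (hx : Ideal.span (Set.range x) = IsLocalRing.maximalIdeal S)
    {K : Ideal S} (hK : HasExceptionalDepthOne x K) {I : Ideal S} (hI : I ≠ ⊥) {r : ℕ}
    (hIK : I * K ^ r = K ^ (r + 1))
    (T : Scheme.{u}) (f : T ⟶ Spec (.of S)) (hf : IsBlowup f (affineBlowup.idealSheaf I)) :
    ∃ (J : T.IdealSheafData) (T' : Scheme.{u}) (π : T' ⟶ T), J ≠ ⊥ ∧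
      (∀ t : T, t ∈ J.support → f.base t = IsLocalRing.closedPoint S) ∧
      IsBlowup π J ∧ Scheme.IsRegular T' :=
  coreRung_reduction_of_depthOne hpkg hstep hD5
    (trivializationPiece_of_steps hA1
      (regularizePeel_of_divisorial (regularizeDivisorial_of_support hA2s hfac)) hCP hCJS)
    hdim x hx hK hI hIK T f hf

end DepthOneTargets

open DepthOneTargets

/-! ## §4 The registered stub's binder shape on the depth-one stratum -/

/-- [OURS · L1 W5.2 · lead] **`DepthOneConclusion` IS the registered core on its stratum.** The hypotheses
of `stub_atomDimFourBlowup` (skeleton `closed_point_slice` v5.1) plus a regular system `x` spanning `𝔪` in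
which `I` has exceptional depth one; characteristic, completeness, residue field and the off-fibre
hypothesis are unused (universe `0`, as registered). [folklore] -/
theorem atomDimFourBlowupAt_of_depthOneConclusion (h : DepthOneConclusion.{0})
    (p : ℕ) (_hp : p.Prime) (S : Type) [CommRing S] [IsRegularLocalRing S] [CharP S p]
    [IsAdicComplete (IsLocalRing.maximalIdeal S) S] [PerfectField (IsLocalRing.ResidueField S)]
    (hdim : ringKrullDim S = (4 : ℕ)) (I : Ideal S) (hI : I ≠ ⊥)
    {n : ℕ} (x : Fin n → S) (hx : Ideal.span (Set.range x) = IsLocalRing.maximalIdeal S)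
    (hdepth : HasExceptionalDepthOne x I)
    (T : Scheme.{0}) (f : T ⟶ Spec (.of S)) (hf : IsBlowup f (affineBlowup.idealSheaf I))
    (_hoff : ∀ t : T, f.base t ≠ IsLocalRing.closedPoint S →
      IsRegularLocalRing (T.presheaf.stalk t)) :
    ∃ (J : T.IdealSheafData) (T' : Scheme.{0}) (π : T' ⟶ T), J ≠ ⊥ ∧
      (∀ t : T, t ∈ J.support → f.base t = IsLocalRing.closedPoint S) ∧
      IsBlowup π J ∧ Scheme.IsRegular T' :=
  h S hdim n x hx I hI hdepth T f hf

/-! ## §5 The composition of record with the depth-one stratum split off -/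

/-- [OURS · L1 W5.2 · lead] **The crux `FrobeniusClosing.PatchingRelPerfect` BY NAME from the printed
dimension-`≤ 3` inputs, the depth-one rung, the open core ON THE COMPLEMENT STRATUM, and the dimension-`≥ 5`
residual.** The complement stratum: complete regular local `S` of dimension four, characteristic `p`, perfect
residue field, `I ≠ 0` with blowing up regular off `V(𝔪)` and of exceptional depth one in NO finite family
spanning `𝔪`. CONDITIONAL (every hypothesis but the printed ones is open or parked); the item stays open;
`DepthOneConclusion` itself is `depthOne_of_targets'` modulo six typed targets and two named facts.
[cite: CossartPiltant2019, Thm. 1.1 and Prop. 4.4] [cite: CossartJannsenSaito2020, Thm. 1.2]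
[cite: StacksProject, Tag 080A] -/
theorem patchingRelPerfect_of_printed_of_depthOne_of_deeper_of_dimGeFive
    (hG : CossartPiltant2019General.{0}) (hP : CossartPiltant2019Principalization.{0})
    (hCJS : ∀ (X : Scheme.{0}) [IsNoetherian X] [IsReduced X], Scheme.IsExcellent X →
      topologicalKrullDim X ≤ 2 → Scheme.AdmitsDesingularization X)
    (hd1 : DepthOneConclusion.{0})
    (hdeep : ∀ (p : ℕ), p.Prime → ∀ (S : Type) [CommRing S] [IsRegularLocalRing S] [CharP S p]
      [IsAdicComplete (IsLocalRing.maximalIdeal S) S]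
      [PerfectField (IsLocalRing.ResidueField S)], ringKrullDim S = (4 : ℕ) →
      ∀ (I : Ideal S), I ≠ ⊥ →
        (∀ (n : ℕ) (x : Fin n → S), Ideal.span (Set.range x) = IsLocalRing.maximalIdeal S →
          ¬ HasExceptionalDepthOne x I) →
        ∀ (T : Scheme.{0}) (f : T ⟶ Spec (.of S)),
        IsBlowup f (affineBlowup.idealSheaf I) →
        (∀ t : T, f.base t ≠ IsLocalRing.closedPoint S → IsRegularLocalRing (T.presheaf.stalk t)) →
        ∃ (J : T.IdealSheafData) (T' : Scheme.{0}) (π : T' ⟶ T), J ≠ ⊥ ∧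
          (∀ t : T, t ∈ J.support → f.base t = IsLocalRing.closedPoint S) ∧
          IsBlowup π J ∧ Scheme.IsRegular T')
    (h5 : ∀ (p : ℕ), p.Prime →
      (∀ (k K : Type) [Field k] [CharP k p] [PerfectField k] [Field K] [Algebra k K],
        (⊤ : IntermediateField k K).FG → ∀ O : ValuationSubring K, (∀ c : k, algebraMap k K c ∈ O) →
          ∀ R : Subalgebra k K, R.FG → R.toSubring ≤ O.toSubring →
            ∃ (A : Subalgebra k K) (h : A.toSubring ≤ O.toSubring), R ≤ A ∧ A.FG ∧
              IsFractionRing A K ∧ IsRegularLocalRing (Localization.AtPrime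
                (Ideal.comap (Subring.inclusion h) (IsLocalRing.maximalIdeal O)))) →
      ∀ (k : Type) [Field k] [CharP k p] [PerfectField k] (X : Scheme.{0}) (f : X ⟶ Spec (.of k)),
        IsSeparated f → LocallyOfFiniteType f → QuasiCompact f → IsIntegral X →
        ¬ topologicalKrullDim X ≤ 4 → Scheme.HasResolution X) :
    Summit.ResolutionOfSingularities.ResolutionOfSingularities.Theses.FrobeniusClosing.PatchingRelPerfect :=
  patchingRelPerfect_of_printed_of_atomDimFourBlowup_of_dimGeFive hG hP hCJS
    (fun p hp S _ _ _ _ _ hdim I hI T f hf hoff => by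
      by_cases h : ∃ (n : ℕ) (x : Fin n → S),
          Ideal.span (Set.range x) = IsLocalRing.maximalIdeal S ∧ HasExceptionalDepthOne x I
      · obtain ⟨n, x, hx, hdepth⟩ := h
        exact hd1 S hdim n x hx I hI hdepth T f hf
      · push Not at h
        exact hdeep p hp S hdim I hI h T f hf hoff)
    h5

end Summit.ResolutionOfSingularities.ResolutionOfSingularities.Theorems

end
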